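import Summits.KontsevichZagierPeriods.KontsevichZagierPeriods.Theses.SymplecticScissors
import Summits.KontsevichZagierPeriods.KontsevichZagierPeriods.Theorems.SymplecticScissorsEqualJacobianTransport

/-!
# `PlanarCompiler`, line `twist-restoring-shear`: the sheared transport (stub 4, the lever)

Crux stmt-KontsevichZagierPeriods-10058 (route SymplecticScissors), stub `stub_shearedTransport`
of the lead skeleton `Cruxes/PlanarCompiler/Lines/twist-restoring-shear.lean`.

On an open `ℚ`-semialgebraic `U ⊆ ℝ²` let `A, B` be `ℚ`-semialgebraic and `C¹` with
`∂_bA = ∂_aB ≠ 0`, and let the two Lagrangian projections `Ψ₁ p = (p 0, A p)`,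
`Ψ₂ p = (p 1, B p)` be injective on `U`. Then the integrand-`1` representations on `Ψ₁ '' U` and
`Ψ₂ '' U` differ by ONE change-of-variables instance. This is the route's engine
`EqualJacobianTransport` (`Theorems/SymplecticScissorsEqualJacobianTransport.lean`: transition map
`Ψ₂ ∘ (Ψ₁|U)⁻¹`, inverse function theorem, Tarski–Seidenberg) specialised to the two projections:
`DΨ₁ = (e₀, DA)` has determinant `∂_bA`, `DΨ₂ = (e₁, DB)` has determinant `−∂_aB`, so
`|det DΨ₁| = |det DΨ₂| ≠ 0`.

References: M. Kontsevich, D. Zagier, *Periods* (2001), §1.2 rule (2); V. I. Arnold,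
*Mathematical Methods of Classical Mechanics* (1989), §48 (generating functions of symplectic maps).
-/

noncomputable section

open MeasureTheory Set
open Literature.NumberTheory.Transcendental Literature.ModelTheory.ExponentialFields
open Summit.KontsevichZagierPeriods.KontsevichZagierPeriods.Theses.SymplecticScissors

namespace Summit.KontsevichZagierPeriods.SymplecticScissors.PlanarCompilerProof

/-- Derivative of a sheared projection `p ↦ (p i, F p)`: the continuous linear map with rows
`e_i^*` and `DF(p)`. [folklore] -/
theorem hasFDerivAt_shearProj {F : (Fin 2 → ℝ) → ℝ} {F' : (Fin 2 → ℝ) →L[ℝ] ℝ} {p : Fin 2 → ℝ}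
    (hF : HasFDerivAt F F' p) (i : Fin 2) :
    HasFDerivAt (fun q : Fin 2 → ℝ => (![q i, F q] : Fin 2 → ℝ))
      (ContinuousLinearMap.pi ![ContinuousLinearMap.proj i, F']) p := by
  refine hasFDerivAt_pi'.2 (Fin.forall_fin_two.2 ⟨?_, ?_⟩)
  · simp only [Matrix.cons_val_zero, ContinuousLinearMap.proj_pi]
    exact hasFDerivAt_apply i p
  · simp only [Matrix.cons_val_one, ContinuousLinearMap.proj_pi]
    exact hF

/-- `det (e₀^*, F') = F' e₁` for a linear form `F'` on `ℝ²`. [folklore] -/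
theorem det_pi_proj_zero (F' : (Fin 2 → ℝ) →L[ℝ] ℝ) :
    (ContinuousLinearMap.pi ![ContinuousLinearMap.proj 0, F'] :
      (Fin 2 → ℝ) →L[ℝ] (Fin 2 → ℝ)).det = F' (Pi.single 1 1) := by
  show LinearMap.det ((ContinuousLinearMap.pi ![ContinuousLinearMap.proj 0, F'] :
    (Fin 2 → ℝ) →L[ℝ] (Fin 2 → ℝ)) : (Fin 2 → ℝ) →ₗ[ℝ] (Fin 2 → ℝ)) = _
  rw [← LinearMap.det_toMatrix', Matrix.det_fin_two]
  simp [LinearMap.toMatrix'_apply]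

/-- `det (e₁^*, F') = -F' e₀` for a linear form `F'` on `ℝ²`. [folklore] -/
theorem det_pi_proj_one (F' : (Fin 2 → ℝ) →L[ℝ] ℝ) :
    (ContinuousLinearMap.pi ![ContinuousLinearMap.proj 1, F'] :
      (Fin 2 → ℝ) →L[ℝ] (Fin 2 → ℝ)).det = -F' (Pi.single 0 1) := by
  show LinearMap.det ((ContinuousLinearMap.pi ![ContinuousLinearMap.proj 1, F'] :
    (Fin 2 → ℝ) →L[ℝ] (Fin 2 → ℝ)) : (Fin 2 → ℝ) →ₗ[ℝ] (Fin 2 → ℝ)) = _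
  rw [← LinearMap.det_toMatrix', Matrix.det_fin_two]
  simp [LinearMap.toMatrix'_apply]

/-- **Stub 4 (the lever; = route support `EqualJacobianTransport` specialised).** On an open
`ℚ`-semialgebraic `U` where `A, B` are `C¹` with `∂_bA = ∂_aB ≠ 0` and both Lagrangian
projections `Ψ₁ = (a, A)`, `Ψ₂ = (b, B)` injective, `[Ψ₁ U] − [Ψ₂ U]` is ONE change-of-variables
instance (`Φ = Ψ₂ ∘ Ψ₁⁻¹`, inverse function theorem, `|det DΦ| = |∂_aB| / |∂_bA| = 1`).
[folklore] -/
theorem stub_shearedTransport :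
    ∀ (U : Set (Fin 2 → ℝ)) (A B : (Fin 2 → ℝ) → ℝ), IsOpen U → IsSemialgebraic ℚ U → IsSemialgebraicFunOn ℚ U A → IsSemialgebraicFunOn ℚ U B → ContDiffOn ℝ 1 A U → ContDiffOn ℝ 1 B U → (∀ p ∈ U, fderiv ℝ A p (Pi.single 1 1) = fderiv ℝ B p (Pi.single 0 1)) → (∀ p ∈ U, fderiv ℝ A p (Pi.single 1 1) ≠ 0) → Set.InjOn (fun p : Fin 2 → ℝ => (![p 0, A p] : Fin 2 → ℝ)) U → Set.InjOn (fun p : Fin 2 → ℝ => (![p 1, B p] : Fin 2 → ℝ)) U → ∀ r r' : KZ.IntegralRep 2, r.domain = (fun p : Fin 2 → ℝ => (![p 0, A p] : Fin 2 → ℝ)) '' U → r'.domain = (fun p : Fin 2 → ℝ => (![p 1, B p] : Fin 2 → ℝ)) '' U → (∀ q ∈ r.domain, r.integrand q = 1) → (∀ q ∈ r'.domain, r'.integrand q = 1) → KZ.of r - KZ.of r' ∈ KZ.changeOfVariablesRel := by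
  intro U A B hUo hUsa hA hB hAC1 hBC1 hAB hne hinj₁ hinj₂ r r' hr hr' hri hri'
  -- the derivatives of the two sheared projections
  have hΨ₁ : ∀ p ∈ U, fderiv ℝ (fun p : Fin 2 → ℝ => (![p 0, A p] : Fin 2 → ℝ)) p =
      ContinuousLinearMap.pi ![ContinuousLinearMap.proj 0, fderiv ℝ A p] := fun p hp =>
    (hasFDerivAt_shearProj
      ((hAC1.contDiffAt (hUo.mem_nhds hp)).differentiableAt one_ne_zero).hasFDerivAt 0).fderiv
  have hΨ₂ : ∀ p ∈ U, fderiv ℝ (fun p : Fin 2 → ℝ => (![p 1, B p] : Fin 2 → ℝ)) p =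
      ContinuousLinearMap.pi ![ContinuousLinearMap.proj 1, fderiv ℝ B p] := fun p hp =>
    (hasFDerivAt_shearProj
      ((hBC1.contDiffAt (hUo.mem_nhds hp)).differentiableAt one_ne_zero).hasFDerivAt 1).fderiv
  refine EqualJacobianTransport.equalJacobianTransport 2 U _ _ hUo hUsa ?_ ?_ ?_ ?_ hinj₁ hinj₂
    ?_ ?_ r r' hr hr' hri hri'
  · -- `Ψ₁` is a semialgebraic map: its coordinates are
    exact IsSemialgebraicMapOn.of_forall hUsa (Fin.forall_fin_two.2
      ⟨by simpa using isSemialgebraicFunOn_aeval hUsa (MvPolynomial.X 0 : MvPolynomial (Fin 2) ℚ), by simpa using hA⟩)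
  · exact IsSemialgebraicMapOn.of_forall hUsa (Fin.forall_fin_two.2
      ⟨by simpa using isSemialgebraicFunOn_aeval hUsa (MvPolynomial.X 1 : MvPolynomial (Fin 2) ℚ), by simpa using hB⟩)
  · -- `Ψ₁` is `C¹`: its coordinates are
    exact contDiffOn_pi' (Fin.forall_fin_two.2
      ⟨by simpa using (contDiff_apply ℝ ℝ (0 : Fin 2)).contDiffOn, by simpa using hAC1⟩)
  · exact contDiffOn_pi' (Fin.forall_fin_two.2
      ⟨by simpa using (contDiff_apply ℝ ℝ (1 : Fin 2)).contDiffOn, by simpa using hBC1⟩)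
  · -- `det DΨ₁ = ∂_bA ≠ 0`
    intro p hp
    rw [hΨ₁ p hp, det_pi_proj_zero]
    exact hne p hp
  · -- `|det DΨ₁| = |∂_bA| = |−∂_aB| = |det DΨ₂|`
    intro p hp
    rw [hΨ₁ p hp, hΨ₂ p hp, det_pi_proj_zero, det_pi_proj_one, abs_neg, hAB p hp]

/-- The same statement under the name of the registered sub-goal `stub_shearedTransport_openCell` of the
crux item (the stub registry currently tracks a second skeleton whose `stub_shearedTransport` differs;
this is the open-cell engine form of the line file `Cruxes/PlanarCompiler/Lines/twist-restoring-shear.lean`).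
[folklore] -/
theorem stub_shearedTransport_openCell :
    ∀ (U : Set (Fin 2 → ℝ)) (A B : (Fin 2 → ℝ) → ℝ), IsOpen U → IsSemialgebraic ℚ U → IsSemialgebraicFunOn ℚ U A → IsSemialgebraicFunOn ℚ U B → ContDiffOn ℝ 1 A U → ContDiffOn ℝ 1 B U → (∀ p ∈ U, fderiv ℝ A p (Pi.single 1 1) = fderiv ℝ B p (Pi.single 0 1)) → (∀ p ∈ U, fderiv ℝ A p (Pi.single 1 1) ≠ 0) → Set.InjOn (fun p : Fin 2 → ℝ => (![p 0, A p] : Fin 2 → ℝ)) U → Set.InjOn (fun p : Fin 2 → ℝ => (![p 1, B p] : Fin 2 → ℝ)) U → ∀ r r' : KZ.IntegralRep 2, r.domain = (fun p : Fin 2 → ℝ => (![p 0, A p] : Fin 2 → ℝ)) '' U → r'.domain = (fun p : Fin 2 → ℝ => (![p 1, B p] : Fin 2 → ℝ)) '' U → (∀ q ∈ r.domain, r.integrand q = 1) → (∀ q ∈ r'.domain, r'.integrand q = 1) → KZ.of r - KZ.of r' ∈ KZ.changeOfVariablesRel :=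
  stub_shearedTransport

end Summit.KontsevichZagierPeriods.SymplecticScissors.PlanarCompilerProof
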